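import Literature.MathematicalPhysics.QuantumFieldTheory.Balaban1983to89.B7Prop4FlatCarriedLetterRec

/-!
# `Balaban1983to89.B7Prop4FlatCarriedLetterOscRec` — THE FLAT CARRIED GAUGE LETTER `Θ_j` OF THE RECORD's LINEARISED AVERAGING ([Balaban1987RG1] (0.4)) KILLS CONSTANT-CURL FIELDS
# ON CENTRED BLOCKS; hence the OSCILLATION form of its curvature bound: `‖Θ_j(B)(z)‖ ≤ (d·s)²·Σ_{i<j}L^{2i}·osc(dB)` — the data term of [Balaban1985RegularSpaces] (1.59) for
# the record operator `linCovIterZ L 1 = Ŷ_j + dΘ_j` (`B7Prop4FlatCarriedLetterRec.linCovIterZ_one_eq`)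

statement-level skeleton of published theorems with citation tags; proofs where landed; nothing here is a claim about the Yang–Mills mass gap

CITATION HEADER (lean-in-tree rule).  Cell `pub-ymgap`, seat `pub-ymgap-dag-n05-cov` g0 (director-ym R509 (a): proof of the record's flat named facts
`B8Ineq159FlatCovPrintedRec.Ineq159Flat(Dented)CubeMemberCovPrintedZ`; `--kind proof --supports stmt-QuantumFields-20541`, K0⁷, count-neutral).  Sources READ: [3] =
[Balaban1985Averaging] (112) p. 34, (122)–(127) pp. 36–37; [I] = [Balaban1987RG1] (0.3)–(0.4) pp. 252–253 («x − y = Σ_μ δn_μe_μ, |n_μ| ≦ (L−1)∕2» — CENTRED blocks, ALL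
shortest staircases); [6] = [Balaban1985RegularSpaces] (1.56)–(1.59) p. 86.  REUSED BY NAME: `B7Prop4FlatCarriedLetterRec.norm_carried_flat_le_loc` (the curvature bound from a LOCAL
curl bound, for ANY `Θ` obeying the recursion `Θ₀ = 0`, `Θ_{j+1}(z) = (R̄Θ_j)(Lz) + Φ_{Ŷ_j}(Lz)`), `B7Prop3StaircaseStokesRec.PhiZ_eq_mean`, `B7Prop3FlatRecSide.{PhiZ, SZ, sum_IdxZ_fst}`,
`B7Prop3GaugeCarryRec.{lamZ_one_left, lamZ_sub, lamZ_smul, lamZ_add}`, `B7Prop3PureGaugeRec.{dcovF, rlamZ_eq}`, `B7Prop4GaugeInductionRec.{carryIter, carryIter_succ}`,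
`B7SectEFLinearisationRec.{linQZ, linQIterZ}`, `B7Prop4Flat.asum_sub`, `B7Prop3Flat.asum_smul`, `B8Lemma1NonAbelian.{tw, tw_cons, treeWord_eq_tw}`, `B8Lemma1NonAbelianRecLoops.stairWord_eq_tw`,
`T4Continuum.{negAt, negAt_self, negAt_of_ne}` (`BlockAveraging`), `BlockAveragingZd.{offZ, IdxZ, l1_offZ_le}`.

WHY.  The record's flat linearised `j`-fold average is `Ŷ_j + dΘ_j` ([3] (127) + the carried letter), and the only bound on `Θ_j` in the tree is by `sup|dB|`
(`norm_carried_flat_le_loc`), which is of the same size as the datum of (1.59) itself.  On CENTRED blocks of odd side `L = 2s+1` the letter does better: the mean over the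
offset box `{−s,…,s}ᵈ` of every monomial `n_μn_κ` (`μ ≠ κ`) vanishes (reflection `n_μ ↦ −n_μ`), so `Φ` — and with it `Θ_j` — ANNIHILATES every field with constant curl
(`A₀(x)_λ = Σ_μ (x_μ∕2)·f_{μλ}`, `f` antisymmetric), and the curvature bound may be applied to `B − A₀`: `Θ_j` is controlled by the OSCILLATION of `dB` over the block tower, which
the discrete Campanato estimate (`B8FlatCurlOscillationZd`) makes small — the mechanism of the bootstrap proving (1.59) for the record operator from its straight twin.

WHAT IS PROVED (sorry-free; proof lane — 0 `def`; the linear potentials are passed as fields `P`, `A` with their defining equations `hP`, `hA` as hypotheses and instantiated by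
lambdas in §5).
* §1 linearity at the flat background: `PhiZ_sub ∕ _add ∕ _smul ∕ _zero ∕ _finset_sum`, `linQZ_sub' ∕ _smul'`, `linQIterZ_sub ∕ _smul`, `rlamZ_one_sub ∕ _zero`, ★ `carryIter_flat_sub`
  (the canonical carried letter is subtractive in `B`).
* §2 centred-offset symmetry (odd `L`): `offZ_update_rev` (`n(r with r_μ reflected) = negAt μ (n r)`), `update_rev_update_rev`, ★ `sum_offZ_comp_negAt` (`Σ_r g(n_r) = Σ_r g(negAt μ n_r)`),
  `sum_offZ_coord_eq_zero`.
* §3 the elementary potentials `P^{μκ}(x)_λ = [λ = κ]·(x_μ∕2)·c` (`μ ≠ κ`): `coord_add_zsmul_e_of_ne`, `asum_elem_seg_self(_natCast)`, `asum_elem_seg_of_ne`, `asum_elem_tw_eq_zero_of_not_mem`,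
  ★★ `asum_elem_tw_add_asum_elem_tw_negAt` (the paired-orderings identity), `stairDiff_add_stairDiff_negAt`, `sum_stairDiff_offZ_eq_zero`, ★★ `PhiZ_elem_eq_zero`.
* §4 the linear potential `A₀(x)_λ = Σ_μ (x_μ∕2)·f_{μλ}`: `linPot_eq_sum_elem`, ★★ `PhiZ_linPot_eq_zero` (zero diagonal), `linPot_add`, `asum_plaqWord_linPot` (`dA₀ = f`, `f` antisymmetric),
  `asum_linPot_seg`, ★ `linQZ_linPot_rescale` (`Ŷ-step A₀ = L²·A₀`), `linQIterZ_linPot`, `PhiZ_linQIterZ_linPot_eq_zero`, ★★ `carryIter_linPot_eq_zero` (`Θ_j(A₀) = 0`).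
* §5 `asum_plaqWord_swap`, ★★★ `norm_carried_flat_le_osc` — `‖Θ_j(B)(z)‖ ≤ (d·s)²·M·Σ_{i<j}(L²)^i` whenever `‖B(∂p_{μν}(x)) − B(∂p_{μν}(y))‖ ≤ M` for `|x − y|₁ ≤ R` and
  `|L^jz − y|₁ + (d·s+2L)L^j ≤ R` (`L = 2s+1`, `s ≥ 1`).
HONEST SCOPE.  Flat abelian-linear bookkeeping (finite sums, reflections of the offset box); nothing of [3]∕[6]∕[I] asserted; `HThm4Rec` UNDISCHARGED; N05 ∕ N07 NOT discharged;
counts unmoved; one finite 𝕋⁴ programme at fixed ε — nothing continuum ∕ ℝ⁴ ∕ OS ∕ mass gap ∕ Clay.  NEW file; modifies nothing.  No `instance`, no `notation`, no `sorry`.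
-/

set_option autoImplicit false

noncomputable section

open scoped BigOperators
open Finset

namespace Literature.MathematicalPhysics.QuantumFieldTheory.Balaban1983to89.B7Prop4FlatCarriedLetterOscRec

open B7Prop1Explicit hiding Site
open B7Prop1Explicit renaming Site → SiteZ
open B7Eq78Linearization (conjR conjR_apply conjR_sub conjR_smul_real)
open BlockAveragingZd (offZ offZ_apply IdxZ l1_offZ_le)
open B7SectEFLinearisationRec (linQZ linQIterZ linQIterZ_zero linQIterZ_succ rlamZ FhatZ)
open B7Prop3FlatRecSide (PhiZ SZ sum_IdxZ_fst)
open B7Prop3StaircaseStokesRec (PhiZ_eq_mean)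
open B7Prop3GaugeCarryRec (lamZ lamZ_one_left lamZ_sub lamZ_smul lamZ_add)
open B7Prop3PureGaugeRec (dcovF dcovF_apply rlamZ_eq)
open B7Prop4GaugeInductionRec (carryIter carryIter_zero carryIter_succ)
open B7Prop4Flat (asum_sub)
open B7Prop3Flat (asum_smul)
open B7Prop4FlatCarriedLetterRec (norm_carried_flat_le_loc)
open B8Lemma1NonAbelian (tw tw_nil tw_cons treeWord_eq_tw)
open B8Lemma1NonAbelianRecLoops (stairWord_eq_tw)
open T4Continuum (stairWord negAt negAt_self negAt_of_ne negAt_negAt)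

variable {d : ℕ}

variable {𝔸 : Type*} [NormedRing 𝔸] [NormedAlgebra ℂ 𝔸] [NormOneClass 𝔸] [CompleteSpace 𝔸] (L : ℕ)

/-! ## §1 Linearity at the flat background -/

section Linear

omit [NormOneClass 𝔸] [CompleteSpace 𝔸] in
/-- `Φ` is subtractive (`Φ = λ(1)`, `lamZ_sub`). [cite: Balaban1985Averaging, (112) p.34, (122) p.36] -/
theorem PhiZ_sub (A A' : SiteZ d → Fin d → 𝔸) (q : SiteZ d) : PhiZ L (A - A') q = PhiZ L A q - PhiZ L A' q := by
  rw [← lamZ_one_left, ← lamZ_one_left, ← lamZ_one_left, lamZ_sub]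

omit [NormOneClass 𝔸] [CompleteSpace 𝔸] in
/-- `Φ` is additive. [cite: Balaban1985Averaging, (112) p.34, (122) p.36] -/
theorem PhiZ_add (A A' : SiteZ d → Fin d → 𝔸) (q : SiteZ d) : PhiZ L (A + A') q = PhiZ L A q + PhiZ L A' q := by
  rw [← lamZ_one_left, ← lamZ_one_left, ← lamZ_one_left, lamZ_add]

omit [NormOneClass 𝔸] [CompleteSpace 𝔸] in
/-- `Φ` is `ℂ`-homogeneous. [cite: Balaban1985Averaging, (112) p.34, (122) p.36] -/
theorem PhiZ_smul (c : ℂ) (A : SiteZ d → Fin d → 𝔸) (q : SiteZ d) : PhiZ L (c • A) q = c • PhiZ L A q := by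
  rw [← lamZ_one_left, ← lamZ_one_left, lamZ_smul]

omit [NormOneClass 𝔸] [CompleteSpace 𝔸] in
/-- `Φ(0) = 0`. [cite: Balaban1985Averaging, (112) p.34] -/
theorem PhiZ_zero (q : SiteZ d) : PhiZ L (0 : SiteZ d → Fin d → 𝔸) q = 0 := by
  have h := PhiZ_sub L (0 : SiteZ d → Fin d → 𝔸) 0 q
  rwa [sub_zero, sub_self] at h

omit [NormOneClass 𝔸] [CompleteSpace 𝔸] in
/-- `Φ` of a finite sum of fields. [cite: Balaban1985Averaging, (112) p.34, (122) p.36] -/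
theorem PhiZ_finset_sum {ι : Type*} (s : Finset ι) (A : ι → SiteZ d → Fin d → 𝔸) (q : SiteZ d) :
    PhiZ L (∑ i ∈ s, A i) q = ∑ i ∈ s, PhiZ L (A i) q := by
  classical
  induction s using Finset.induction_on with
  | empty => rw [Finset.sum_empty, Finset.sum_empty, PhiZ_zero]
  | insert i s hi ih => rw [Finset.sum_insert hi, Finset.sum_insert hi, PhiZ_add, ih]

omit [NormOneClass 𝔸] [CompleteSpace 𝔸] in
/-- `L·Q₀` is subtractive. [cite: Balaban1985Averaging, (125) p.36] -/
theorem linQZ_sub' (A A' : SiteZ d → Fin d → 𝔸) (q : SiteZ d) (κ : Fin d) : linQZ L (A - A') q κ = linQZ L A q κ - linQZ L A' q κ := by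
  unfold linQZ
  simp only [asum_sub, smul_sub, Finset.sum_sub_distrib]

omit [NormOneClass 𝔸] [CompleteSpace 𝔸] in
/-- `L·Q₀` is `ℝ`-homogeneous. [cite: Balaban1985Averaging, (125) p.36] -/
theorem linQZ_smul' (t : ℝ) (A : SiteZ d → Fin d → 𝔸) (q : SiteZ d) (κ : Fin d) : linQZ L (t • A) q κ = t • linQZ L A q κ := by
  unfold linQZ
  simp only [asum_smul, Finset.smul_sum, smul_comm t]

omit [NormOneClass 𝔸] [CompleteSpace 𝔸] in
/-- The straight iterate `Ŷ_j` is subtractive in `B`. [cite: Balaban1985Averaging, (127) p.37] -/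
theorem linQIterZ_sub (A A' : SiteZ d → Fin d → 𝔸) : ∀ j : ℕ, linQIterZ L (A - A') j = linQIterZ L A j - linQIterZ L A' j
  | 0 => rfl
  | j + 1 => by
    funext z κ
    rw [Pi.sub_apply, Pi.sub_apply, linQIterZ_succ, linQIterZ_succ, linQIterZ_succ, linQIterZ_sub A A' j, linQZ_sub']

omit [NormOneClass 𝔸] [CompleteSpace 𝔸] in
/-- The straight iterate `Ŷ_j` is `ℝ`-homogeneous in `B`. [cite: Balaban1985Averaging, (127) p.37] -/
theorem linQIterZ_smul (t : ℝ) (A : SiteZ d → Fin d → 𝔸) : ∀ j : ℕ, linQIterZ L (t • A) j = t • linQIterZ L A j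
  | 0 => rfl
  | j + 1 => by
    funext z κ
    rw [Pi.smul_apply, Pi.smul_apply, linQIterZ_succ, linQIterZ_succ, linQIterZ_smul t A j, linQZ_smul']

omit [NormOneClass 𝔸] [CompleteSpace 𝔸] in
/-- The rotated block mean at the flat background is subtractive. [cite: Balaban1985Averaging, (78) p.30, (211) p.49] -/
theorem rlamZ_one_sub (f g : SiteZ d → 𝔸) (y : SiteZ d) :
    rlamZ L (1 : SiteZ d → Fin d → 𝔸ˣ) (f - g) y = rlamZ L (1 : SiteZ d → Fin d → 𝔸ˣ) f y - rlamZ L (1 : SiteZ d → Fin d → 𝔸ˣ) g y := by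
  simp only [rlamZ_eq, Pi.sub_apply, conjR_sub, smul_sub, Finset.sum_sub_distrib]

omit [NormOneClass 𝔸] [CompleteSpace 𝔸] in
/-- The rotated block mean of the zero function vanishes. [cite: Balaban1985Averaging, (78) p.30] -/
theorem rlamZ_one_zero (y : SiteZ d) : rlamZ L (1 : SiteZ d → Fin d → 𝔸ˣ) (0 : SiteZ d → 𝔸) y = 0 := by
  have h := rlamZ_one_sub L (0 : SiteZ d → 𝔸) 0 y
  rwa [sub_zero, sub_self] at h

omit [NormOneClass 𝔸] [CompleteSpace 𝔸] in
/-- ★ **THE CANONICAL CARRIED LETTER IS SUBTRACTIVE IN `B`**: `Θ_j(B − A) = Θ_j(B) − Θ_j(A)` — its recursion `Θ₀ = 0`, `Θ_{j+1}(z) = (R̄Θ_j)(Lz) + Φ_{Ŷ_j}(Lz)` is linear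
(`R̄`, `Φ`, `Ŷ_j` are). [cite: Balaban1985Averaging, (93) p.31, (124) p.36, (127) p.37; Balaban1987RG1, (0.4) p.253] -/
theorem carryIter_flat_sub (B A : SiteZ d → Fin d → 𝔸) : ∀ j : ℕ,
    carryIter (fun _ θ w => rlamZ L (1 : SiteZ d → Fin d → 𝔸ˣ) θ ((L : ℤ) • w)) (fun _ A' w => lamZ L (1 : SiteZ d → Fin d → 𝔸ˣ) A' ((L : ℤ) • w))
        (linQIterZ L (B - A)) j =
      carryIter (fun _ θ w => rlamZ L (1 : SiteZ d → Fin d → 𝔸ˣ) θ ((L : ℤ) • w)) (fun _ A' w => lamZ L (1 : SiteZ d → Fin d → 𝔸ˣ) A' ((L : ℤ) • w))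
          (linQIterZ L B) j -
        carryIter (fun _ θ w => rlamZ L (1 : SiteZ d → Fin d → 𝔸ˣ) θ ((L : ℤ) • w)) (fun _ A' w => lamZ L (1 : SiteZ d → Fin d → 𝔸ˣ) A' ((L : ℤ) • w))
          (linQIterZ L A) j
  | 0 => by simp
  | j + 1 => by
    funext z
    rw [carryIter_succ, carryIter_succ, carryIter_succ, Pi.add_apply, Pi.sub_apply, Pi.add_apply, Pi.add_apply, carryIter_flat_sub B A j,
      rlamZ_one_sub, linQIterZ_sub, lamZ_sub]
    abel

end Linear

/-! ## §2 The centred offset box is symmetric under the reflection of one coordinate (odd `L`) -/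

section Reflection

/-- Reflecting the `μ`-th block coordinate `r_μ ↦ L − 1 − r_μ` (`Fin.rev`) negates the `μ`-th centred offset and keeps the others (odd `L = 2s+1`):
`offZ L (update r μ (rev r_μ)) = negAt μ (offZ L r)`. [cite: Balaban1987RG1, (0.3) p.252] -/
theorem offZ_update_rev {s : ℕ} (hLs : L = 2 * s + 1) (r : Fin d → Fin L) (μ : Fin d) :
    offZ L (Function.update r μ (Fin.rev (r μ))) = negAt μ (offZ L r) := by
  funext ν
  by_cases h : ν = μ
  · subst h
    have hr := (r ν).isLt
    rw [negAt_self, offZ_apply, offZ_apply, Function.update_self, Fin.val_rev]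
    have hs : (L - 1) / 2 = s := by omega
    rw [hs]
    have h1 : ((L - (r ν + 1) : ℕ) : ℤ) = (L : ℤ) - (r ν : ℕ) - 1 := by omega
    rw [h1]
    omega
  · rw [negAt_of_ne μ _ h, offZ_apply, offZ_apply, Function.update_of_ne h]

/-- The reflection of the `μ`-th block coordinate as an involution of the index box `{0,…,L−1}ᵈ`. [folklore] [cite: Balaban1987RG1, (0.3) p.252] -/
theorem update_rev_update_rev (r : Fin d → Fin L) (μ : Fin d) :
    Function.update (Function.update r μ (Fin.rev (r μ))) μ (Fin.rev ((Function.update r μ (Fin.rev (r μ))) μ)) = r := by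
  funext ν
  by_cases h : ν = μ
  · subst h; simp
  · simp [Function.update_of_ne h]

/-- ★ **REFLECTION SYMMETRY OF THE CENTRED OFFSET BOX**: `Σ_r g(n_r) = Σ_r g(negAt μ n_r)` for every function `g` of the centred offset (odd `L`). [cite: Balaban1987RG1, (0.3) p.252] -/
theorem sum_offZ_comp_negAt {M : Type*} [AddCommMonoid M] {s : ℕ} (hLs : L = 2 * s + 1) (μ : Fin d) (g : SiteZ d → M) :
    ∑ r : Fin d → Fin L, g (offZ L r) = ∑ r : Fin d → Fin L, g (negAt μ (offZ L r)) := by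
  let ρ : (Fin d → Fin L) ≃ (Fin d → Fin L) :=
    { toFun := fun r => Function.update r μ (Fin.rev (r μ)), invFun := fun r => Function.update r μ (Fin.rev (r μ)),
      left_inv := fun r => update_rev_update_rev L r μ, right_inv := fun r => update_rev_update_rev L r μ }
  rw [← Equiv.sum_comp ρ (fun r => g (offZ L r))]
  refine Finset.sum_congr rfl fun r _ => ?_
  show g (offZ L (Function.update r μ (Fin.rev (r μ)))) = g (negAt μ (offZ L r))
  rw [offZ_update_rev L hLs]

/-- **The centred offsets have mean zero in every coordinate** (odd `L`): `Σ_r (n_r)_μ = 0` in `ℂ`. [cite: Balaban1987RG1, (0.3) p.252] -/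
theorem sum_offZ_coord_eq_zero {s : ℕ} (hLs : L = 2 * s + 1) (μ : Fin d) : ∑ r : Fin d → Fin L, ((offZ L r μ : ℤ) : ℂ) = 0 := by
  have h := sum_offZ_comp_negAt L hLs μ (fun n : SiteZ d => ((n μ : ℤ) : ℂ))
  simp only [negAt_self, Int.cast_neg, Finset.sum_neg_distrib] at h
  have h2 : (2 : ℂ) * ∑ r : Fin d → Fin L, ((offZ L r μ : ℤ) : ℂ) = 0 := by rw [two_mul]; nth_rewrite 2 [h]; rw [add_neg_cancel]
  exact (mul_eq_zero.1 h2).resolve_left two_ne_zero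

end Reflection

/-! ## §3 The elementary linear potentials `P^{μκ}(x)_λ = [λ = κ]·(x_μ∕2)·c` (`μ ≠ κ`): `Φ` annihilates them -/

section Elementary

open T4Continuum (nodup_finRange_map mem_finRange_map)

omit [NormedAlgebra ℂ 𝔸] [NormOneClass 𝔸] [CompleteSpace 𝔸] in
/-- the `μ`-coordinate is constant along a `κ`-run (`μ ≠ κ`). [folklore] [cite: Balaban1987RG1, (0.3) p.252] -/
theorem coord_add_zsmul_e_of_ne {μ κ : Fin d} (hμκ : μ ≠ κ) (p : SiteZ d) (t : ℤ) : (p + t • e κ) μ = p μ := by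
  rw [Pi.add_apply, Pi.smul_apply, e_apply, if_neg hμκ, smul_zero, add_zero]

variable {μ κ : Fin d} (hμκ : μ ≠ κ) (c : 𝔸) (P : SiteZ d → Fin d → 𝔸) (hP : ∀ (x : SiteZ d) (lam : Fin d), P x lam = if lam = κ then (((x μ : ℤ) : ℂ) / 2) • c else 0)
include hμκ hP

omit [NormOneClass 𝔸] [CompleteSpace 𝔸] in
/-- `P^{μκ}` along a forward `κ`-run of `m` steps from `p`: `m·(p_μ∕2)·c`. [cite: Balaban1987RG1, (0.3) p.252] -/
theorem asum_elem_seg_self_natCast (p : SiteZ d) (m : ℕ) : asum P p (seg κ (m : ℤ)) = (m : ℂ) • ((((p μ : ℤ) : ℂ) / 2) • c) := by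
  rw [asum_seg_natCast]
  have h : ∀ i ∈ Finset.range m, P (p + (i : ℤ) • e κ) κ = (((p μ : ℤ) : ℂ) / 2) • c := fun i _ => by
    rw [hP, if_pos rfl, coord_add_zsmul_e_of_ne hμκ]
  rw [Finset.sum_congr rfl h, Finset.sum_const, Finset.card_range, ← Nat.cast_smul_eq_nsmul ℂ]

omit [NormOneClass 𝔸] [CompleteSpace 𝔸] in
/-- `P^{μκ}` along a `κ`-run of signed length `k` from `p`: `k·(p_μ∕2)·c` (both orientations). [cite: Balaban1987RG1, (0.3) p.252] -/
theorem asum_elem_seg_self (p : SiteZ d) (k : ℤ) : asum P p (seg κ k) = (k : ℂ) • ((((p μ : ℤ) : ℂ) / 2) • c) := by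
  obtain ⟨m, rfl | rfl⟩ := Int.eq_nat_or_neg k
  · exact asum_elem_seg_self_natCast hμκ c P hP p m
  · rw [asum_seg_neg, asum_elem_seg_self_natCast hμκ c P hP, show p - ((m : ℕ) : ℤ) • e κ = p + (-((m : ℕ) : ℤ)) • e κ from by rw [neg_smul, sub_eq_add_neg],
      coord_add_zsmul_e_of_ne hμκ, ← neg_smul, Int.cast_neg, Int.cast_natCast]

omit [NormOneClass 𝔸] [CompleteSpace 𝔸] hμκ in
/-- `P^{μκ}` along a run of another axis `a ≠ κ` vanishes. [cite: Balaban1987RG1, (0.3) p.252] -/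
theorem asum_elem_seg_of_ne {a : Fin d} (ha : a ≠ κ) (p : SiteZ d) (k : ℤ) : asum P p (seg a k) = 0 := by
  have hnat : ∀ (q : SiteZ d) (m : ℕ), asum P q (seg a (m : ℤ)) = 0 := fun q m => by
    rw [asum_seg_natCast]
    exact Finset.sum_eq_zero fun i _ => by rw [hP, if_neg ha]
  obtain ⟨m, rfl | rfl⟩ := Int.eq_nat_or_neg k
  · exact hnat p m
  · rw [asum_seg_neg, hnat, neg_zero]

omit [NormOneClass 𝔸] [CompleteSpace 𝔸] hμκ in
/-- `P^{μκ}` along a staircase through axes not containing `κ` vanishes. [cite: Balaban1987RG1, (0.3) p.252] -/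
theorem asum_elem_tw_eq_zero_of_not_mem (n : SiteZ d) : ∀ (ks : List (Fin d)) (x : SiteZ d), κ ∉ ks → asum P x (tw ks n) = 0
  | [], x, _ => by simp
  | a :: ks, x, h => by
    rw [List.mem_cons, not_or] at h
    rw [B7Prop3StaircaseStokesRec.asum_tw_cons, asum_elem_seg_of_ne c P hP (Ne.symm h.1), asum_elem_tw_eq_zero_of_not_mem n ks _ h.2, add_zero]

omit [NormOneClass 𝔸] [CompleteSpace 𝔸] in
/-- ★★ **THE PAIRED-ORDERINGS IDENTITY**: for a duplicate-free axis list `ks ∋ κ` and base points `x, x′`,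
`P^{μκ}(tw ks n from x) + P^{μκ}(tw ks (negAt μ n) from x′) = n_κ·((x_μ + x′_μ)∕2)·c` — INDEPENDENT of the ordering `ks`: only the `κ`-run contributes, with the
`μ`-coordinate of its starting point, and reflecting `n_μ` exchanges the two possible starting coordinates. [cite: Balaban1987RG1, (0.3)–(0.4) pp.252–253] -/
theorem asum_elem_tw_add_asum_elem_tw_negAt (n : SiteZ d) :
    ∀ (ks : List (Fin d)) (x x' : SiteZ d), ks.Nodup → κ ∈ ks →
      asum P x (tw ks n) + asum P x' (tw ks (negAt μ n)) = (n κ : ℂ) • ((((x μ + x' μ : ℤ) : ℂ) / 2) • c)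
  | [], x, x', _, h => absurd h List.not_mem_nil
  | a :: ks, x, x', hnd, hmem => by
    rw [List.nodup_cons] at hnd
    rw [B7Prop3StaircaseStokesRec.asum_tw_cons, B7Prop3StaircaseStokesRec.asum_tw_cons]
    by_cases ha : a = κ
    · subst ha
      rw [asum_elem_tw_eq_zero_of_not_mem c P hP n ks _ hnd.1, asum_elem_tw_eq_zero_of_not_mem c P hP (negAt μ n) ks _ hnd.1, add_zero, add_zero,
        asum_elem_seg_self hμκ c P hP, asum_elem_seg_self hμκ c P hP, negAt_of_ne μ n (Ne.symm hμκ), ← smul_add, ← add_smul, ← add_div, Int.cast_add]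
    · have hmem' : κ ∈ ks := by
        rcases List.mem_cons.1 hmem with h | h
        · exact absurd h.symm ha
        · exact h
      rw [asum_elem_seg_of_ne c P hP ha, asum_elem_seg_of_ne c P hP ha, zero_add, zero_add,
        asum_elem_tw_add_asum_elem_tw_negAt n ks _ _ hnd.2 hmem']
      congr 3
      -- the sum of the `μ`-coordinates of the two base points is preserved
      by_cases haμ : a = μ
      · subst haμ
        rw [negAt_self, Pi.add_apply, Pi.add_apply, Pi.smul_apply, Pi.smul_apply, e_apply, if_pos rfl]
        ring
      · rw [Pi.add_apply, Pi.add_apply, Pi.smul_apply, Pi.smul_apply, e_apply, if_neg (Ne.symm haμ)]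
        simp only [smul_zero, add_zero]

omit [NormOneClass 𝔸] [CompleteSpace 𝔸] in
/-- The staircase difference `D(n) = P^{μκ}(Γ^σ_{q,q+n}) − P^{μκ}(Γ_{q,q+n})` is ODD under `n_μ ↦ −n_μ`: `D(n) + D(negAt μ n) = 0`. [cite: Balaban1987RG1, (0.3)–(0.4) pp.252–253] -/
theorem stairDiff_add_stairDiff_negAt (q n : SiteZ d) (σ : Equiv.Perm (Fin d)) :
    (asum P q (stairWord σ n) - asum P q (treeWord n)) + (asum P q (stairWord σ (negAt μ n)) - asum P q (treeWord (negAt μ n))) = 0 := by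
  rw [stairWord_eq_tw, stairWord_eq_tw, treeWord_eq_tw, treeWord_eq_tw]
  have h1 := asum_elem_tw_add_asum_elem_tw_negAt hμκ c P hP n ((List.finRange d).map σ) q q (nodup_finRange_map σ) (mem_finRange_map σ κ)
  have h2 := asum_elem_tw_add_asum_elem_tw_negAt hμκ c P hP n (List.finRange d).reverse q q
    (List.nodup_reverse.mpr (List.nodup_finRange d)) (List.mem_reverse.mpr (List.mem_finRange κ))
  rw [show ∀ a b a' b' : 𝔸, (a - b) + (a' - b') = (a + a') - (b + b') from fun _ _ _ _ => by abel, h1, h2, sub_self]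

omit [NormOneClass 𝔸] [CompleteSpace 𝔸] in
/-- The mean over the centred offset box of the staircase difference of `P^{μκ}` vanishes (odd `L`). [cite: Balaban1987RG1, (0.3)–(0.4) pp.252–253] -/
theorem sum_stairDiff_offZ_eq_zero {s : ℕ} (hLs : L = 2 * s + 1) (q : SiteZ d) (σ : Equiv.Perm (Fin d)) :
    ∑ r : Fin d → Fin L, (asum P q (stairWord σ (offZ L r)) - asum P q (treeWord (offZ L r))) = 0 := by
  set D : SiteZ d → 𝔸 := fun n => asum P q (stairWord σ n) - asum P q (treeWord n) with hD
  have hrefl := sum_offZ_comp_negAt L hLs μ D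
  have hsum : ∑ r : Fin d → Fin L, D (offZ L r) + ∑ r : Fin d → Fin L, D (negAt μ (offZ L r)) = 0 := by
    rw [← Finset.sum_add_distrib]
    exact Finset.sum_eq_zero fun r _ => stairDiff_add_stairDiff_negAt hμκ c P hP q (offZ L r) σ
  rw [← hrefl, ← two_smul ℂ] at hsum
  exact (smul_eq_zero.1 hsum).resolve_left two_ne_zero

omit [NormOneClass 𝔸] [CompleteSpace 𝔸] in
/-- ★★ **`Φ` ANNIHILATES THE ELEMENTARY LINEAR POTENTIAL `P^{μκ}`** (`μ ≠ κ`, centred blocks of odd side). [cite: Balaban1987RG1, (0.3)–(0.4) pp.252–253; Balaban1985Averaging, (112) p.34] -/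
theorem PhiZ_elem_eq_zero {s : ℕ} (hLs : L = 2 * s + 1) (q : SiteZ d) : PhiZ L P q = 0 := by
  have hL : 1 ≤ L := by omega
  rw [PhiZ_eq_mean P L hL q, Fintype.sum_prod_type, Finset.sum_comm]
  refine Finset.sum_eq_zero fun p _ => ?_
  rw [← Finset.smul_sum, sum_stairDiff_offZ_eq_zero L hμκ c P hP hLs q p.1, smul_zero]

end Elementary

/-! ## §4 The linear potential `A₀(x)_λ = Σ_μ (x_μ∕2)·f_{μλ}` of an antisymmetric `f`: curl, straight average, carried letter -/

section LinPot

variable (f : Fin d → Fin d → 𝔸) (A : SiteZ d → Fin d → 𝔸) (hA : ∀ (x : SiteZ d) (lam : Fin d), A x lam = ∑ μ : Fin d, (((x μ : ℤ) : ℂ) / 2) • f μ lam)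
include hA

omit [NormOneClass 𝔸] [CompleteSpace 𝔸] in
/-- `A₀` is the sum of the elementary potentials `P^{μκ}` with `c = f_{μκ}`. [cite: Balaban1987RG1, (0.3) p.252 (bookkeeping)] -/
theorem linPot_eq_sum_elem : A = ∑ μ : Fin d, ∑ κ : Fin d, fun x lam => if lam = κ then (((x μ : ℤ) : ℂ) / 2) • f μ κ else 0 := by
  funext x lam
  rw [hA, Finset.sum_apply, Finset.sum_apply]
  refine Finset.sum_congr rfl fun μ _ => ?_
  rw [Finset.sum_apply, Finset.sum_apply, Finset.sum_ite_eq, if_pos (Finset.mem_univ _)]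

omit [NormOneClass 𝔸] [CompleteSpace 𝔸] in
/-- ★★ **`Φ` ANNIHILATES `A₀`** when `f` has zero diagonal (odd `L`): the diagonal potentials vanish identically, the others by `PhiZ_elem_eq_zero`.
[cite: Balaban1987RG1, (0.3)–(0.4) pp.252–253; Balaban1985Averaging, (112) p.34] -/
theorem PhiZ_linPot_eq_zero (hf0 : ∀ μ, f μ μ = 0) {s : ℕ} (hLs : L = 2 * s + 1) (q : SiteZ d) : PhiZ L A q = 0 := by
  rw [linPot_eq_sum_elem f A hA, PhiZ_finset_sum]
  refine Finset.sum_eq_zero fun μ _ => ?_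
  rw [PhiZ_finset_sum]
  refine Finset.sum_eq_zero fun κ _ => ?_
  by_cases hμκ : μ = κ
  · subst hμκ
    have h0 : (fun (x : SiteZ d) (lam : Fin d) => if lam = μ then (((x μ : ℤ) : ℂ) / 2) • f μ μ else 0) = 0 := by
      funext x lam; rw [hf0, smul_zero, ite_self]; rfl
    rw [h0, PhiZ_zero]
  · exact PhiZ_elem_eq_zero L hμκ (f μ κ) _ (fun _ _ => rfl) hLs q

omit [NormOneClass 𝔸] [CompleteSpace 𝔸] in
/-- `A₀` is affine in the position: `A₀(p + v)_λ = A₀(p)_λ + Σ_μ (v_μ∕2)·f_{μλ}`. [cite: Balaban1987RG1, (0.3) p.252 (bookkeeping)] -/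
theorem linPot_add (p v : SiteZ d) (lam : Fin d) : A (p + v) lam = A p lam + ∑ μ : Fin d, (((v μ : ℤ) : ℂ) / 2) • f μ lam := by
  rw [hA, hA, ← Finset.sum_add_distrib]
  refine Finset.sum_congr rfl fun μ _ => ?_
  rw [Pi.add_apply, Int.cast_add, add_div, add_smul]

omit [NormOneClass 𝔸] [CompleteSpace 𝔸] in
/-- **`dA₀ = f`** for antisymmetric `f`: `A₀(∂p_{αβ}(x)) = f_{αβ}`. [cite: Balaban1985BackgroundPropagators, (3.4) p.391; Balaban1987RG1, (0.3) p.252] -/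
theorem asum_plaqWord_linPot (hfa : ∀ α β, f β α = -f α β) (x : SiteZ d) (α β : Fin d) : asum A x (plaqWord α β) = f α β := by
  rw [asum_plaqWord, linPot_add f A hA x (e α), linPot_add f A hA x (e β)]
  simp only [e_apply, Int.cast_ite, Int.cast_one, Int.cast_zero]
  have h1 : ∑ μ : Fin d, ((if μ = α then (1 : ℂ) else 0) / 2) • f μ β = ((1 : ℂ) / 2) • f α β := by
    rw [Finset.sum_eq_single α (fun μ _ hμ => by rw [if_neg hμ, zero_div, zero_smul]) (fun h => absurd (Finset.mem_univ α) h), if_pos rfl]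
  have h2 : ∑ μ : Fin d, ((if μ = β then (1 : ℂ) else 0) / 2) • f μ α = ((1 : ℂ) / 2) • f β α := by
    rw [Finset.sum_eq_single β (fun μ _ hμ => by rw [if_neg hμ, zero_div, zero_smul]) (fun h => absurd (Finset.mem_univ β) h), if_pos rfl]
  rw [h1, h2, hfa α β, smul_neg]
  have h3 : ((1 : ℂ) / 2) • f α β + ((1 : ℂ) / 2) • f α β = f α β := by rw [← add_smul, add_halves, one_smul]
  set T := ((1 : ℂ) / 2) • f α β with hT
  calc A x α + (A x β + T) - (A x α + -T) - A x β = T + T := by abel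
    _ = f α β := h3

omit [NormOneClass 𝔸] [CompleteSpace 𝔸] in
/-- `A₀` along a forward `κ`-run of `m` steps: `m·A₀(p)_κ` (zero diagonal). [cite: Balaban1985Averaging, (125) p.36; Balaban1987RG1, (0.3) p.252] -/
theorem asum_linPot_seg (hf0 : ∀ μ, f μ μ = 0) (p : SiteZ d) (κ : Fin d) (m : ℕ) : asum A p (seg κ (m : ℤ)) = (m : ℂ) • A p κ := by
  rw [asum_seg_natCast]
  have h : ∀ i ∈ Finset.range m, A (p + (i : ℤ) • e κ) κ = A p κ := fun i _ => by
    rw [linPot_add f A hA]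
    have hz : ∑ μ : Fin d, (((((i : ℤ) • e κ) μ : ℤ) : ℂ) / 2) • f μ κ = 0 := by
      refine Finset.sum_eq_zero fun μ _ => ?_
      by_cases hμ : μ = κ
      · subst hμ; rw [hf0, smul_zero]
      · rw [Pi.smul_apply, e_apply, if_neg hμ, smul_zero, Int.cast_zero, zero_div, zero_smul]
    rw [hz, add_zero]
  rw [Finset.sum_congr rfl h, Finset.sum_const, Finset.card_range, ← Nat.cast_smul_eq_nsmul ℂ]

omit [NormOneClass 𝔸] [CompleteSpace 𝔸] in
/-- ★ **THE STRAIGHT AVERAGE OF `A₀` ON CENTRED BLOCKS IS `L²·A₀`** (odd `L`, zero diagonal): `L·(Q₀A₀)_{⟨Lz, Lz+Le_κ⟩} = L²·A₀(z)_κ` — the block mean of the affine part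
vanishes because the centred offsets have mean zero. [cite: Balaban1985Averaging, (125) p.36; Balaban1987RG1, (0.3) p.252] -/
theorem linQZ_linPot_rescale (hf0 : ∀ μ, f μ μ = 0) {s : ℕ} (hLs : L = 2 * s + 1) (z : SiteZ d) (κ : Fin d) :
    linQZ L A ((L : ℤ) • z) κ = ((L : ℝ) ^ 2) • A z κ := by
  have hL : 1 ≤ L := by omega
  have hL0 : (L : ℝ) ≠ 0 := by exact_mod_cast (show L ≠ 0 by omega)
  unfold linQZ
  have hterm : ∀ r : Fin d → Fin L, asum A ((L : ℤ) • z + offZ L r) (seg κ (L : ℤ)) =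
      (L : ℂ) • ((L : ℂ) • A z κ) + (L : ℂ) • ∑ μ : Fin d, (((offZ L r μ : ℤ) : ℂ) / 2) • f μ κ := fun r => by
    rw [asum_linPot_seg f A hA hf0, linPot_add f A hA, smul_add]
    congr 2
    simp only [hA, Finset.smul_sum]
    refine Finset.sum_congr rfl fun μ _ => ?_
    rw [Pi.smul_apply, smul_eq_mul, Int.cast_mul, Int.cast_natCast, mul_div_assoc, ← smul_smul]
  simp_rw [hterm, smul_add]
  rw [Finset.sum_add_distrib, Finset.sum_const, Finset.card_univ, Fintype.card_fun, Fintype.card_fin, Fintype.card_fin]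
  have hmean : ∑ r : Fin d → Fin L, (((L : ℝ) ^ d)⁻¹) • ((L : ℂ) • ∑ μ : Fin d, (((offZ L r μ : ℤ) : ℂ) / 2) • f μ κ) = 0 := by
    rw [← Finset.smul_sum, ← Finset.smul_sum, Finset.sum_comm]
    have : ∑ μ : Fin d, ∑ r : Fin d → Fin L, (((offZ L r μ : ℤ) : ℂ) / 2) • f μ κ = 0 := by
      refine Finset.sum_eq_zero fun μ _ => ?_
      rw [← Finset.sum_smul, ← Finset.sum_div, sum_offZ_coord_eq_zero L hLs μ, zero_div, zero_smul]
    rw [this, smul_zero, smul_zero]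
  have hone : (L ^ d : ℕ) • ((((L : ℝ) ^ d)⁻¹) • ((L : ℂ) • ((L : ℂ) • A z κ))) = (L : ℂ) • ((L : ℂ) • A z κ) := by
    rw [← Nat.cast_smul_eq_nsmul ℝ, smul_smul, Nat.cast_pow, mul_inv_cancel₀ (pow_ne_zero d hL0), one_smul]
  have hLL : (L : ℂ) • ((L : ℂ) • A z κ) = ((L : ℝ) ^ 2) • A z κ := by
    rw [show (L : ℂ) = ((L : ℝ) : ℂ) by norm_cast, Complex.coe_smul, Complex.coe_smul, smul_smul, sq]
  rw [hmean, add_zero, hone, hLL]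

omit [NormOneClass 𝔸] [CompleteSpace 𝔸] in
/-- **`Ŷ_j(A₀) = L^{2j}·A₀`** (odd `L`, zero diagonal): the linear potential is an eigenfield of the straight centred average. [cite: Balaban1985Averaging, (125) p.36, (127) p.37; Balaban1987RG1, (0.3) p.252] -/
theorem linQIterZ_linPot (hf0 : ∀ μ, f μ μ = 0) {s : ℕ} (hLs : L = 2 * s + 1) : ∀ j : ℕ, linQIterZ L A j = (((L : ℝ) ^ 2) ^ j) • A
  | 0 => by simp
  | j + 1 => by
    funext z κ
    rw [linQIterZ_succ, linQIterZ_linPot hf0 hLs j, linQZ_smul', linQZ_linPot_rescale L f A hA hf0 hLs, Pi.smul_apply, Pi.smul_apply, smul_smul, ← pow_succ]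

omit [NormOneClass 𝔸] [CompleteSpace 𝔸] in
/-- `Φ(Ŷ_j(A₀)) = 0` (odd `L`, zero diagonal). [cite: Balaban1985Averaging, (112) p.34, (127) p.37; Balaban1987RG1, (0.3)–(0.4) pp.252–253] -/
theorem PhiZ_linQIterZ_linPot_eq_zero (hf0 : ∀ μ, f μ μ = 0) {s : ℕ} (hLs : L = 2 * s + 1) (j : ℕ) (q : SiteZ d) : PhiZ L (linQIterZ L A j) q = 0 := by
  rw [linQIterZ_linPot L f A hA hf0 hLs j, ← Complex.coe_smul, PhiZ_smul, PhiZ_linPot_eq_zero L f A hA hf0 hLs q, smul_zero]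

omit [NormOneClass 𝔸] [CompleteSpace 𝔸] in
/-- ★★ **THE CARRIED LETTER ANNIHILATES THE LINEAR POTENTIAL: `Θ_j(A₀) = 0`** (odd `L`, zero diagonal) — by the recursion `Θ_{j+1} = R̄Θ_j + Φ(Ŷ_j(A₀))` with `Φ(Ŷ_j(A₀)) = 0`.
[cite: Balaban1985Averaging, (93) p.31, (124) p.36, (127) p.37; Balaban1987RG1, (0.4) p.253] -/
theorem carryIter_linPot_eq_zero (hf0 : ∀ μ, f μ μ = 0) {s : ℕ} (hLs : L = 2 * s + 1) : ∀ j : ℕ,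
    carryIter (fun _ θ w => rlamZ L (1 : SiteZ d → Fin d → 𝔸ˣ) θ ((L : ℤ) • w)) (fun _ A' w => lamZ L (1 : SiteZ d → Fin d → 𝔸ˣ) A' ((L : ℤ) • w))
      (linQIterZ L A) j = 0
  | 0 => rfl
  | j + 1 => by
    funext z
    rw [carryIter_succ, carryIter_linPot_eq_zero hf0 hLs j, Pi.add_apply, Pi.zero_apply, rlamZ_one_zero, lamZ_one_left,
      PhiZ_linQIterZ_linPot_eq_zero L f A hA hf0 hLs, add_zero]

end LinPot

/-! ## §5 The oscillation form of the curvature bound -/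

section Osc

omit [NormedAlgebra ℂ 𝔸] [NormOneClass 𝔸] [CompleteSpace 𝔸] in
/-- The plaquette functional is antisymmetric in the two directions: `B(∂p_{νμ}(x)) = −B(∂p_{μν}(x))`. [cite: Balaban1985Averaging, (48) p.25] -/
theorem asum_plaqWord_swap (B : SiteZ d → Fin d → 𝔸) (x : SiteZ d) (μ ν : Fin d) : asum B x (plaqWord ν μ) = -asum B x (plaqWord μ ν) := by
  rw [asum_plaqWord, asum_plaqWord]
  abel

omit [CompleteSpace 𝔸] in
/-- ★★★ **THE OSCILLATION FORM OF THE CURVATURE BOUND OF THE FLAT CARRIED LETTER**: if `‖B(∂p_{μν}(x)) − B(∂p_{μν}(y))‖ ≤ M` for every plaquette within `|·|₁`-radius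
`R` of `y` (the OSCILLATION of the fine curl about its value at `y`, same orientation), then `‖Θ_j(B)(z)‖ ≤ (d·s)²·M·Σ_{i<j}(L²)^i` whenever `|L^jz − y|₁ + (d·s + 2L)·L^j ≤ R`
(`L = 2s+1`, `s ≥ 1`, `Θ_j` the canonical carried letter of `B7Prop4FlatCarriedLetterRec.linCovIterZ_one_eq`): subtract the linear potential `A₀` with `dA₀ ≡ dB(y)`, which `Θ_j`
annihilates (`carryIter_linPot_eq_zero`), and apply `norm_carried_flat_le_loc` to `B − A₀`.
[cite: Balaban1985Averaging, (93) p.31, (112) p.34, (124)–(127) pp.36–37; Balaban1987RG1, (0.3)–(0.4) pp.252–253; Balaban1985RegularSpaces, (1.56)–(1.59) p.86] -/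
theorem norm_carried_flat_le_osc {s : ℕ} (hLs : L = 2 * s + 1) (hs : 1 ≤ s) (B : SiteZ d → Fin d → 𝔸) (y : SiteZ d) (R : ℕ) {M : ℝ} (hM0 : 0 ≤ M)
    (hM : ∀ (x : SiteZ d) (μ ν : Fin d), l1 (x - y) ≤ R → ‖asum B x (plaqWord μ ν) - asum B y (plaqWord μ ν)‖ ≤ M)
    (j : ℕ) (z : SiteZ d) (hz : l1 (((L : ℤ) ^ j) • z - y) + (d * s + 2 * L) * L ^ j ≤ R) :
    ‖carryIter (fun _ θ w => rlamZ L (1 : SiteZ d → Fin d → 𝔸ˣ) θ ((L : ℤ) • w))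
        (fun _ A w => lamZ L (1 : SiteZ d → Fin d → 𝔸ˣ) A ((L : ℤ) • w)) (linQIterZ L B) j z‖
      ≤ ((d : ℝ) * s) ^ 2 * M * ∑ i ∈ range j, ((L : ℝ) ^ 2) ^ i := by
  -- the linear potential with curl `dB(y)`
  set f : Fin d → Fin d → 𝔸 := fun μ ν => asum B y (plaqWord μ ν) with hf
  have hfa : ∀ α β, f β α = -f α β := fun α β => asum_plaqWord_swap B y α β
  have hf0 : ∀ μ, f μ μ = 0 := fun μ => by
    have h := hfa μ μ
    have h2 : (2 : ℂ) • f μ μ = 0 := by rw [two_smul]; nth_rewrite 1 [h]; rw [neg_add_cancel]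
    exact (smul_eq_zero.1 h2).resolve_left two_ne_zero
  set A : SiteZ d → Fin d → 𝔸 := fun x lam => ∑ μ : Fin d, (((x μ : ℤ) : ℂ) / 2) • f μ lam with hAdef
  have hA : ∀ (x : SiteZ d) (lam : Fin d), A x lam = ∑ μ : Fin d, (((x μ : ℤ) : ℂ) / 2) • f μ lam := fun _ _ => rfl
  -- `Θ_j(B) = Θ_j(B − A₀) + Θ_j(A₀) = Θ_j(B − A₀)`
  have hsplit := carryIter_flat_sub L B A j
  rw [carryIter_linPot_eq_zero L f A hA hf0 hLs j, sub_zero] at hsplit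
  rw [← hsplit]
  -- the curvature bound for `B − A₀`, whose curl is `dB − dB(y)` on the ball
  have hM' : ∀ (x : SiteZ d) (μ ν : Fin d), l1 (x - y) ≤ R → ‖asum (B - A) x (plaqWord μ ν)‖ ≤ M := by
    intro x μ ν hx
    rw [asum_sub, asum_plaqWord_linPot f A hA hfa x μ ν]
    exact hM x μ ν hx
  exact norm_carried_flat_le_loc L hLs hs (B - A) hM0 _ rfl (fun j' z' => B7Prop4FlatCarriedLetterRec.carryIter_one_succ L (B - A) j' z') y R hM' j z hz

end Osc


end Literature.MathematicalPhysics.QuantumFieldTheory.Balaban1983to89.B7Prop4FlatCarriedLetterOscRec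

end
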